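import Literature.MathematicalPhysics.KineticTheory.LangevinChainGibbs
import Mathlib.Analysis.SpecialFunctions.Gaussian.GaussianIntegral
import Mathlib.MeasureTheory.Measure.Haar.Unique
import HarnessLib

/-!
# The symmetrised transfer kernel of the pinned anharmonic chain: positivity, bounds, finiteness

Helper file for item `stmt-AtomisticToContinuum-12398` (`SpecificHeatLimit`, route `HeatModeWeylLaw`
of `AtomisticToContinuum/FouriersLaw`). For `P = pinnedChain ω₂ lam β γ` (`ω₂ > 0`, `lam, β ≥ 0`) and
`T > 0`, with `a = e^{-U/4T}`, `k(q, q') = a(q) e^{-V(q'-q)/T} a(q')` and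
`h(q, q') = (U(q) + U(q'))/2 + V(q' - q)` (all entering through defining hypotheses):

* `pinnedChain_U_nonneg`, `pinnedChain_V_nonneg`, `pinnedChain_V_neg`, continuity;
* `mul_exp_neg_div_le`, `sq_mul_exp_neg_div_le` — `x e^{-x/c} ≤ c`, `x² e^{-x/c} ≤ 4c²` (`x ≥ 0`);
* `transferKernel_props` — `k` is continuous (hence jointly measurable), symmetric, `0 < k ≤ 1`;
* `insertionKernel_bounds` — `|k h| ≤ 5T`, `|k h²| ≤ 108 T²`, with joint measurability;
* `siteWeight_props` — `0 < a ≤ 1`, measurable; `|U² a| ≤ 64 T²`;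
* `isFiniteMeasure_siteMeasure`, `siteMeasure_ne_zero` — `ρ = a² dq` is finite and nonzero.

All [folklore]; no definitions.
-/

noncomputable section

open MeasureTheory Set Filter Function
open scoped RealInnerProductSpace ENNReal

namespace Summit.AtomisticToContinuum.FouriersLaw.Theorems.SpecificHeatLimit

open Literature.MathematicalPhysics.KineticTheory.HeatConduction

/-! ### Elementary calculus -/

/-- `x e^{-x/c} ≤ c` for `c > 0` (for `x < 0` the left side is negative). [folklore] -/
theorem mul_exp_neg_div_le {x c : ℝ} (hc : 0 < c) : x * Real.exp (-x / c) ≤ c := by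
  have h1 : x / c ≤ Real.exp (x / c) := by
    have := Real.add_one_le_exp (x / c)
    linarith
  have h2 : x ≤ c * Real.exp (x / c) := by
    rw [div_le_iff₀' hc] at h1
    · exact h1
  rw [neg_div, Real.exp_neg]
  have h3 : 0 < Real.exp (x / c) := Real.exp_pos _
  calc x * (Real.exp (x / c))⁻¹ ≤ c * Real.exp (x / c) * (Real.exp (x / c))⁻¹ := by gcongr
    _ = c := by field_simp

/-- `x² e^{-x/c} ≤ 4 c²` for `x ≥ 0`, `c > 0`. [folklore] -/
theorem sq_mul_exp_neg_div_le {x c : ℝ} (hx : 0 ≤ x) (hc : 0 < c) :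
    x ^ 2 * Real.exp (-x / c) ≤ 4 * c ^ 2 := by
  have h := mul_exp_neg_div_le (x := x) (by positivity : 0 < 2 * c)
  have e : x ^ 2 * Real.exp (-x / c) = (x * Real.exp (-x / (2 * c))) ^ 2 := by
    rw [mul_pow, ← Real.exp_nat_mul]
    congr 2
    push_cast
    field_simp
  rw [e]
  have h0 : 0 ≤ x * Real.exp (-x / (2 * c)) := by positivity
  nlinarith

/-! ### The pinned chain's potentials -/

section Pinned

variable {ω₂ lam β : ℝ}

/-- `U(q) = ω₂ q²/2 + lam q⁴/4 ≥ 0` for `ω₂, lam ≥ 0`. [folklore] -/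
theorem pinnedChain_U_nonneg (hω : 0 ≤ ω₂) (hl : 0 ≤ lam) (γ : ℝ) (x : ℝ) :
    0 ≤ (pinnedChain ω₂ lam β γ).U x := by
  show 0 ≤ ω₂ * x ^ 2 / 2 + lam * x ^ 4 / 4
  positivity

/-- `V(r) = r²/2 + β r⁴/4 ≥ 0` for `β ≥ 0`. [folklore] -/
theorem pinnedChain_V_nonneg (hβ : 0 ≤ β) (γ : ℝ) (r : ℝ) : 0 ≤ (pinnedChain ω₂ lam β γ).V r := by
  show 0 ≤ r ^ 2 / 2 + β * r ^ 4 / 4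
  positivity

/-- `V` is even. [folklore] -/
theorem pinnedChain_V_neg (γ r : ℝ) : (pinnedChain ω₂ lam β γ).V (-r) = (pinnedChain ω₂ lam β γ).V r := by
  show (-r) ^ 2 / 2 + β * (-r) ^ 4 / 4 = r ^ 2 / 2 + β * r ^ 4 / 4
  ring

/-- `U` is continuous. [folklore] -/
theorem pinnedChain_continuous_U (γ : ℝ) : Continuous (pinnedChain ω₂ lam β γ).U := by
  show Continuous fun x : ℝ => ω₂ * x ^ 2 / 2 + lam * x ^ 4 / 4
  fun_prop

/-- `V` is continuous. [folklore] -/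
theorem pinnedChain_continuous_V (γ : ℝ) : Continuous (pinnedChain ω₂ lam β γ).V := by
  show Continuous fun r : ℝ => r ^ 2 / 2 + β * r ^ 4 / 4
  fun_prop

/-- `U(q) ≥ ω₂ q²/2` for `lam ≥ 0`. [folklore] -/
theorem pinnedChain_U_ge (hl : 0 ≤ lam) (γ : ℝ) (x : ℝ) : ω₂ * x ^ 2 / 2 ≤ (pinnedChain ω₂ lam β γ).U x := by
  show ω₂ * x ^ 2 / 2 ≤ ω₂ * x ^ 2 / 2 + lam * x ^ 4 / 4
  nlinarith [sq_nonneg (x ^ 2)]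

/-! ### The site weight `a = e^{-U/4T}`, the kernel `k`, the insertions -/

variable {γ T : ℝ} {a : ℝ → ℝ} {k h : ℝ → ℝ → ℝ}

/-- **The site weight** `a = e^{-U/4T}`: continuous, measurable, `0 < a ≤ 1`, and `U² a ≤ 64 T²`
(`T > 0`, `ω₂, lam ≥ 0`). [folklore] -/
theorem siteWeight_props (hω : 0 ≤ ω₂) (hl : 0 ≤ lam) (hT : 0 < T)
    (ha : ∀ x, a x = Real.exp (-(pinnedChain ω₂ lam β γ).U x / (4 * T))) :
    Continuous a ∧ Measurable a ∧ (∀ x, 0 < a x) ∧ (∀ x, a x ≤ 1) ∧ (∀ x, ‖a x‖ ≤ 1) ∧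
      (∀ x, ‖(pinnedChain ω₂ lam β γ).U x ^ 2 * a x‖ ≤ 64 * T ^ 2) := by
  have hae : a = fun x => Real.exp (-(pinnedChain ω₂ lam β γ).U x / (4 * T)) := funext ha
  have hc : Continuous a := by
    rw [hae]
    exact Real.continuous_exp.comp (((pinnedChain_continuous_U γ).neg).div_const _)
  have hpos : ∀ x, 0 < a x := fun x => by rw [ha]; exact Real.exp_pos _
  have hle : ∀ x, a x ≤ 1 := fun x => by
    rw [ha, Real.exp_le_one_iff, neg_div]
    exact neg_nonpos.2 (div_nonneg (pinnedChain_U_nonneg hω hl γ x) (by positivity))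
  refine ⟨hc, hc.measurable, hpos, hle, fun x => ?_, fun x => ?_⟩
  · rw [Real.norm_of_nonneg (hpos x).le]; exact hle x
  · rw [Real.norm_of_nonneg (mul_nonneg (sq_nonneg _) (hpos x).le), ha]
    calc (pinnedChain ω₂ lam β γ).U x ^ 2 * Real.exp (-(pinnedChain ω₂ lam β γ).U x / (4 * T))
        ≤ 4 * (4 * T) ^ 2 := sq_mul_exp_neg_div_le (pinnedChain_U_nonneg hω hl γ x) (by positivity)
      _ = 64 * T ^ 2 := by ring

/-- **The symmetrised transfer kernel** `k(q, q') = a(q) e^{-V(q'-q)/T} a(q')`: continuous in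
`(q, q')`, symmetric, strictly positive and bounded by `1`. [folklore] -/
theorem transferKernel_props (hω : 0 ≤ ω₂) (hl : 0 ≤ lam) (hβ : 0 ≤ β) (hT : 0 < T)
    (ha : ∀ x, a x = Real.exp (-(pinnedChain ω₂ lam β γ).U x / (4 * T)))
    (hk : ∀ x y, k x y = a x * Real.exp (-(pinnedChain ω₂ lam β γ).V (y - x) / T) * a y) :
    Continuous (uncurry k) ∧ (∀ x y, k x y = k y x) ∧ (∀ x y, 0 < k x y) ∧ (∀ x y, k x y ≤ 1) ∧
      (∀ x y, ‖k x y‖ ≤ 1) := by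
  obtain ⟨hac, -, hapos, hale, -, -⟩ := siteWeight_props (β := β) (γ := γ) hω hl hT ha
  have hke : uncurry k = fun p : ℝ × ℝ =>
      a p.1 * Real.exp (-(pinnedChain ω₂ lam β γ).V (p.2 - p.1) / T) * a p.2 := by
    funext p; exact hk p.1 p.2
  have hkc : Continuous (uncurry k) := by
    rw [hke]
    refine ((hac.comp continuous_fst).mul ?_).mul (hac.comp continuous_snd)
    exact Real.continuous_exp.comp ((((pinnedChain_continuous_V γ).comp
      (continuous_snd.sub continuous_fst)).neg).div_const _)
  have hkpos : ∀ x y, 0 < k x y := fun x y => by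
    rw [hk]; exact mul_pos (mul_pos (hapos x) (Real.exp_pos _)) (hapos y)
  have hkle : ∀ x y, k x y ≤ 1 := fun x y => by
    rw [hk]
    have h1 : Real.exp (-(pinnedChain ω₂ lam β γ).V (y - x) / T) ≤ 1 := by
      rw [Real.exp_le_one_iff, neg_div]
      exact neg_nonpos.2 (div_nonneg (pinnedChain_V_nonneg hβ γ _) hT.le)
    calc a x * Real.exp (-(pinnedChain ω₂ lam β γ).V (y - x) / T) * a y ≤ 1 * 1 * 1 :=
          mul_le_mul (mul_le_mul (hale x) h1 (Real.exp_pos _).le zero_le_one) (hale y) (hapos y).le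
            (by norm_num)
      _ = 1 := by ring
  refine ⟨hkc, fun x y => ?_, hkpos, hkle, fun x y => ?_⟩
  · rw [hk, hk, show x - y = -(y - x) by ring, pinnedChain_V_neg]; ring
  · rw [Real.norm_of_nonneg (hkpos x y).le]; exact hkle x y

/-- **The insertion kernels are bounded**: with `h(q, q') = (U(q) + U(q'))/2 + V(q' - q)`,
`|k h| ≤ 5T` and `|k h²| ≤ 108 T²`, and both `k h`, `k h²` are jointly measurable. [folklore] -/
theorem insertionKernel_bounds (hω : 0 ≤ ω₂) (hl : 0 ≤ lam) (hβ : 0 ≤ β) (hT : 0 < T)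
    (ha : ∀ x, a x = Real.exp (-(pinnedChain ω₂ lam β γ).U x / (4 * T)))
    (hk : ∀ x y, k x y = a x * Real.exp (-(pinnedChain ω₂ lam β γ).V (y - x) / T) * a y)
    (hh : ∀ x y, h x y = ((pinnedChain ω₂ lam β γ).U x + (pinnedChain ω₂ lam β γ).U y) / 2 +
      (pinnedChain ω₂ lam β γ).V (y - x)) :
    Measurable (uncurry fun x y => k x y * h x y) ∧ (∀ x y, ‖k x y * h x y‖ ≤ 5 * T) ∧
      Measurable (uncurry fun x y => k x y * h x y ^ 2) ∧ (∀ x y, ‖k x y * h x y ^ 2‖ ≤ 108 * T ^ 2) ∧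
      (∀ x y, k x y * h x y = k y x * h y x) ∧ (∀ x y, k x y * h x y ^ 2 = k y x * h y x ^ 2) := by
  set P := pinnedChain ω₂ lam β γ with hP
  obtain ⟨hac, -, hapos, hale, -, -⟩ := siteWeight_props (β := β) (γ := γ) hω hl hT ha
  obtain ⟨hkc, hksymm, hkpos, hkle, -⟩ := transferKernel_props hω hl hβ hT ha hk
  have hhc : Continuous (uncurry h) := by
    have : uncurry h = fun p : ℝ × ℝ => (P.U p.1 + P.U p.2) / 2 + P.V (p.2 - p.1) := by
      funext p; exact hh p.1 p.2
    rw [this]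
    refine (((pinnedChain_continuous_U γ).comp continuous_fst).add
      ((pinnedChain_continuous_U γ).comp continuous_snd)).div_const _ |>.add ?_
    exact (pinnedChain_continuous_V γ).comp (continuous_snd.sub continuous_fst)
  have hm1 : Measurable (uncurry fun x y => k x y * h x y) := (hkc.mul hhc).measurable
  have hm2 : Measurable (uncurry fun x y => k x y * h x y ^ 2) := (hkc.mul (hhc.pow 2)).measurable
  have hhsymm : ∀ x y, h x y = h y x := fun x y => by
    rw [hh, hh, show x - y = -(y - x) by ring, pinnedChain_V_neg]; ring
  -- the three pieces `U(x) k`, `U(y) k`, `V k`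
  have hU0 := pinnedChain_U_nonneg (β := β) hω hl γ
  have hV0 := pinnedChain_V_nonneg (ω₂ := ω₂) (lam := lam) hβ γ
  have hexpV : ∀ x y, Real.exp (-P.V (y - x) / T) ≤ 1 := fun x y => by
    rw [Real.exp_le_one_iff, neg_div]; exact neg_nonpos.2 (div_nonneg (hV0 _) hT.le)
  have hUa : ∀ x, P.U x * a x ≤ 4 * T := fun x => by
    rw [ha]; exact mul_exp_neg_div_le (by positivity)
  have hU2a : ∀ x, P.U x ^ 2 * a x ≤ 4 * (4 * T) ^ 2 := fun x => by
    rw [ha]; exact sq_mul_exp_neg_div_le (hU0 x) (by positivity)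
  have hVk : ∀ x y, P.V (y - x) * Real.exp (-P.V (y - x) / T) ≤ T := fun x y =>
    mul_exp_neg_div_le hT
  have hV2k : ∀ x y, P.V (y - x) ^ 2 * Real.exp (-P.V (y - x) / T) ≤ 4 * T ^ 2 := fun x y =>
    sq_mul_exp_neg_div_le (hV0 _) hT
  have hb1 : ∀ x y, ‖k x y * h x y‖ ≤ 5 * T := by
    intro x y
    have hh0 : 0 ≤ h x y := by rw [hh]; exact add_nonneg (by linarith [hU0 x, hU0 y]) (hV0 _)
    rw [Real.norm_of_nonneg (mul_nonneg (hkpos x y).le hh0), hk, hh]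
    set E := Real.exp (-P.V (y - x) / T) with hE
    have hE0 : 0 ≤ E := (Real.exp_pos _).le
    -- `a x E a y ((U x + U y)/2 + V) ≤ (U x a x)/2 + (U y a y)/2 + V E`
    have hEa : ∀ z, E * a z ≤ 1 := fun z => mul_le_one₀ (hexpV x y) (hapos z).le (hale z)
    have haa : a x * a y ≤ 1 := mul_le_one₀ (hale x) (hapos y).le (hale y)
    have t1 : a x * E * a y * (P.U x / 2) ≤ 4 * T / 2 := by
      calc a x * E * a y * (P.U x / 2) = (P.U x * a x) / 2 * (E * a y) := by ring
        _ ≤ 4 * T / 2 * 1 :=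
            mul_le_mul (by linarith [hUa x]) (hEa y) (mul_nonneg hE0 (hapos y).le) (by positivity)
        _ = 4 * T / 2 := by ring
    have t2 : a x * E * a y * (P.U y / 2) ≤ 4 * T / 2 := by
      calc a x * E * a y * (P.U y / 2) = (P.U y * a y) / 2 * (E * a x) := by ring
        _ ≤ 4 * T / 2 * 1 :=
            mul_le_mul (by linarith [hUa y]) (hEa x) (mul_nonneg hE0 (hapos x).le) (by positivity)
        _ = 4 * T / 2 := by ring
    have t3 : a x * E * a y * P.V (y - x) ≤ T := by
      calc a x * E * a y * P.V (y - x) = (P.V (y - x) * E) * (a x * a y) := by ring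
        _ ≤ T * 1 := mul_le_mul (hVk x y) haa (mul_nonneg (hapos x).le (hapos y).le) hT.le
        _ = T := by ring
    calc a x * E * a y * ((P.U x + P.U y) / 2 + P.V (y - x))
        = a x * E * a y * (P.U x / 2) + a x * E * a y * (P.U y / 2) + a x * E * a y * P.V (y - x) := by
          ring
      _ ≤ 4 * T / 2 + 4 * T / 2 + T := add_le_add (add_le_add t1 t2) t3
      _ = 5 * T := by ring
  have hb2 : ∀ x y, ‖k x y * h x y ^ 2‖ ≤ 108 * T ^ 2 := by
    intro x y
    rw [Real.norm_of_nonneg (mul_nonneg (hkpos x y).le (sq_nonneg _)), hk, hh]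
    set E := Real.exp (-P.V (y - x) / T) with hE
    have hE0 : 0 ≤ E := (Real.exp_pos _).le
    have hsq : ((P.U x + P.U y) / 2 + P.V (y - x)) ^ 2 ≤
        3 * ((P.U x / 2) ^ 2 + (P.U y / 2) ^ 2 + P.V (y - x) ^ 2) := by
      nlinarith [sq_nonneg (P.U x / 2 - P.U y / 2), sq_nonneg (P.U x / 2 - P.V (y - x)),
        sq_nonneg (P.U y / 2 - P.V (y - x))]
    have hEa : ∀ z, E * a z ≤ 1 := fun z => mul_le_one₀ (hexpV x y) (hapos z).le (hale z)
    have haa : a x * a y ≤ 1 := mul_le_one₀ (hale x) (hapos y).le (hale y)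
    have t1 : a x * E * a y * (P.U x / 2) ^ 2 ≤ 4 * (4 * T) ^ 2 / 4 := by
      calc a x * E * a y * (P.U x / 2) ^ 2 = (P.U x ^ 2 * a x) / 4 * (E * a y) := by ring
        _ ≤ 4 * (4 * T) ^ 2 / 4 * 1 :=
            mul_le_mul (by linarith [hU2a x]) (hEa y) (mul_nonneg hE0 (hapos y).le) (by positivity)
        _ = 4 * (4 * T) ^ 2 / 4 := by ring
    have t2 : a x * E * a y * (P.U y / 2) ^ 2 ≤ 4 * (4 * T) ^ 2 / 4 := by
      calc a x * E * a y * (P.U y / 2) ^ 2 = (P.U y ^ 2 * a y) / 4 * (E * a x) := by ring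
        _ ≤ 4 * (4 * T) ^ 2 / 4 * 1 :=
            mul_le_mul (by linarith [hU2a y]) (hEa x) (mul_nonneg hE0 (hapos x).le) (by positivity)
        _ = 4 * (4 * T) ^ 2 / 4 := by ring
    have t3 : a x * E * a y * P.V (y - x) ^ 2 ≤ 4 * T ^ 2 := by
      calc a x * E * a y * P.V (y - x) ^ 2 = (P.V (y - x) ^ 2 * E) * (a x * a y) := by ring
        _ ≤ 4 * T ^ 2 * 1 :=
            mul_le_mul (hV2k x y) haa (mul_nonneg (hapos x).le (hapos y).le) (by positivity)
        _ = 4 * T ^ 2 := by ring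
    have hkk : 0 ≤ a x * E * a y := mul_nonneg (mul_nonneg (hapos x).le hE0) (hapos y).le
    calc a x * E * a y * ((P.U x + P.U y) / 2 + P.V (y - x)) ^ 2
        ≤ a x * E * a y * (3 * ((P.U x / 2) ^ 2 + (P.U y / 2) ^ 2 + P.V (y - x) ^ 2)) :=
          mul_le_mul_of_nonneg_left hsq hkk
      _ = 3 * (a x * E * a y * (P.U x / 2) ^ 2 + a x * E * a y * (P.U y / 2) ^ 2 +
            a x * E * a y * P.V (y - x) ^ 2) := by ring
      _ ≤ 3 * (4 * (4 * T) ^ 2 / 4 + 4 * (4 * T) ^ 2 / 4 + 4 * T ^ 2) := by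
          linarith [t1, t2, t3]
      _ = 108 * T ^ 2 := by ring
  exact ⟨hm1, hb1, hm2, hb2, fun x y => by rw [hksymm, hhsymm], fun x y => by rw [hksymm, hhsymm]⟩

/-! ### The one-site measure `ρ = a² dq` -/

/-- `a²` is dominated by a Gaussian and hence integrable (`ω₂ > 0`). [folklore] -/
theorem integrable_siteWeight_sq (hω : 0 < ω₂) (hl : 0 ≤ lam) (hT : 0 < T)
    (ha : ∀ x, a x = Real.exp (-(pinnedChain ω₂ lam β γ).U x / (4 * T))) :
    Integrable fun x => a x ^ 2 := by
  obtain ⟨hac, -, hapos, -, -, -⟩ := siteWeight_props (β := β) (γ := γ) hω.le hl hT ha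
  have hg : Integrable fun x : ℝ => Real.exp (-(ω₂ / (4 * T)) * x ^ 2) :=
    integrable_exp_neg_mul_sq (by positivity)
  refine hg.mono (hac.pow 2).aestronglyMeasurable (Eventually.of_forall fun x => ?_)
  rw [Real.norm_of_nonneg (sq_nonneg _), Real.norm_of_nonneg (Real.exp_pos _).le, ha,
    ← Real.exp_nat_mul, Real.exp_le_exp]
  push_cast
  have := pinnedChain_U_ge (ω₂ := ω₂) (β := β) hl γ x
  rw [show (2 : ℝ) * (-(pinnedChain ω₂ lam β γ).U x / (4 * T)) =
    -((pinnedChain ω₂ lam β γ).U x / (2 * T)) by field_simp; ring]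
  rw [show -(ω₂ / (4 * T)) * x ^ 2 = -((ω₂ * x ^ 2 / 2) / (2 * T)) by field_simp; ring]
  exact neg_le_neg (div_le_div_of_nonneg_right this (by positivity))

/-- **The one-site measure `ρ = a² dq` is finite.** [folklore] -/
theorem isFiniteMeasure_siteMeasure (hω : 0 < ω₂) (hl : 0 ≤ lam) (hT : 0 < T)
    (ha : ∀ x, a x = Real.exp (-(pinnedChain ω₂ lam β γ).U x / (4 * T))) {ρ : Measure ℝ}
    (hρ : ρ = volume.withDensity fun x => ENNReal.ofReal (a x ^ 2)) : IsFiniteMeasure ρ := by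
  rw [hρ]
  exact isFiniteMeasure_withDensity_ofReal (integrable_siteWeight_sq hω hl hT ha).hasFiniteIntegral

/-- **The one-site measure is nonzero** (indeed `ρ(ℝ) > 0`). [folklore] -/
theorem siteMeasure_ne_zero (hω : 0 < ω₂) (hl : 0 ≤ lam) (hT : 0 < T)
    (ha : ∀ x, a x = Real.exp (-(pinnedChain ω₂ lam β γ).U x / (4 * T))) {ρ : Measure ℝ}
    (hρ : ρ = volume.withDensity fun x => ENNReal.ofReal (a x ^ 2)) : ρ ≠ 0 := by
  obtain ⟨hac, -, hapos, -, -, -⟩ := siteWeight_props (β := β) (γ := γ) hω.le hl hT ha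
  intro h0
  have h1 : ρ univ = 0 := by rw [h0]; rfl
  rw [hρ, withDensity_apply _ MeasurableSet.univ, Measure.restrict_univ,
    lintegral_eq_zero_iff (hac.measurable.pow_const 2).ennreal_ofReal] at h1
  -- a continuous function vanishing a.e. for Lebesgue measure vanishes everywhere
  have hcont : Continuous fun x => ENNReal.ofReal (a x ^ 2) :=
    ENNReal.continuous_ofReal.comp (hac.pow 2)
  have h2 : (fun x => ENNReal.ofReal (a x ^ 2)) = fun _ => (0 : ℝ≥0∞) :=
    (Continuous.ae_eq_iff_eq volume hcont continuous_const).1 h1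
  have h3 := congrFun h2 0
  simp only [ENNReal.ofReal_eq_zero] at h3
  exact absurd h3 (not_le.2 (pow_pos (hapos 0) 2))

end Pinned

end Summit.AtomisticToContinuum.FouriersLaw.Theorems.SpecificHeatLimit

end
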